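import Summits.QuantumFields.YangMills.Theorems.BalabanUVNodesK0V23Stub3FlowGronwallDoorAx
import Summits.QuantumFields.YangMills.Theorems.BalabanUVNodesK0V23Stub3DoorSuppliersAx

/-!
# K0ᴬ (stmt-QuantumFields-27238 `Record13SepCoPHInhabitedAx`) — THE FLOW-GRÖNWALL ROWS COMPOSED WITH THE RE-CENTRED RADIUS DOORS OF RECORD (H3.3 Ax edition of
# `…K0V23Stub3FlowGronwallRadiusDoors`): rows at ONE re-centred member per SMALL (resp. COFINAL) radius ⟹ (α_small)ᴬˣ `K0BoxSmallRadiiAx` (resp. (α_cof)ᴬˣ `K0BoxCofinalRadiiAx`)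
# ⟹ K0ᴬ's decl `Theses.BalabanUVNodes.Record13SepCoPHInhabitedAx` BY NAME — the END shape of a lens-2 g1 line at the RE-CENTRED record (director-ym №399 (2), №467 (D))

Cell `pub-ymgap` (YM-PLAN Track A, D-0062), width seat `pub-ymgap-dag-n07-w3` (g23; helper strictly BELOW the registered |β|-box stub 3ᴬ′ᴮ of K0ᴬ).
`--kind proof --supports stmt-QuantumFields-27238 --as helper` (K0ᴬ), COUNT-NEUTRAL.  NEW leaf; theorems only — 0 `def`, 0 `sorry`, 0 `instance`, 0 `notation`; standard axioms.
Imports the two RE-CENTRED NODE O door leaves: the SHAPE∕MEMORY axis `…K0V23Stub3FlowGronwallDoorAx` (this seat, CLAIM-1: §2 `k0BoxSmallRadiiAxAt_of_flowRowsHist`; through it the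
bare `…K0V23Stub3FlowGronwallDoor` ✓p781946∕p783667 whose CENTRE-BLIND Grönwall ∕ readout ∕ format-predicate lemmas `betaBox_of_flowRowsHistOn`, `fmt_uniform_of_fmtStep`,
`fmt_uniform_of_fmtStepMem` are used BY NAME) and the RADIUS axis `…K0V23Stub3DoorSuppliersAx` (dag-n07-w3 g22 ✓p809897: the K0 DOORS LIST re-centred, `K0BoxSmallRadiiAx` ⟸
`K0BoxCofinalRadiiAx` ⟸ `K0CompCofinalRadiiAx`, each ⟹ `Record13SepCoPHInhabitedAx` by a named 0-sorry theorem) — hence sits in the Theses cone like the latter.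
[I] = [Balaban1987RG1]; [II] = [Balaban1989LargeFieldII]; [15] = [Balaban1985Variational]; [III] = [Balaban1988Convergent].

WHAT (σ-image of the bare module ✓p782959∕p784292, dag-n07-w3 g18: `betaOfRecord₁₃ ↦ betaOfRecord₁₃Ax`, `theta13OfThm1CCMWZB ↦ theta13OfThm1CCMWZBAx`, doors and decl ↦ their
`…Ax` twins; every proof the bare module's, one token changed):
* ★★ `k0BoxSmallRadiiAx_of_flowRowsHist` — for every `F` SOME `a⋆ > 0` below which every radius `a₀` admits ONE re-centred member `theta13OfThm1CCMWZBAx F 2 j ½ a₀ ε₀ ε₂₉ B₃ B₃′ a₀ a₁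
  Efl logz`, box sides `0 < γ ≤ γ̄` and flow data carrying the FOUR ROWS (full-memory one-step row with constant source, base, readout + base readout with slack, cap) for that member's
  RE-CENTRED β of record ⟹ `K0BoxSmallRadiiAx`;  ★★★ `record13SepCoPHInhabitedAx_of_flowRowsHist` — the same hypothesis ⟹ `Theses.BalabanUVNodes.Record13SepCoPHInhabitedAx`.
* `k0BoxCofinalRadiiAx_of_flowRowsHistCofinal` ∕ `record13SepCoPHInhabitedAx_of_flowRowsHistCofinal` — the COFINAL editions (rows at ONE member for radii accumulating at `0`).
* ★★★ `record13SepCoPHInhabitedAx_of_fmtStepMem` ∕ `record13SepCoPHInhabitedAx_of_fmtStep` — the FORMAT-PREDICATE ENDs (lens-2's `lineEnd` shape: `FmtAt` monotone, lens-1's road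
  `hRoad` displayed — now reading the RE-CENTRED β —, ONE k-free stub below thresholds; through (α_small)ᴬˣ and the bare `fmt_uniform_of_fmtStepMem` ∕ `fmt_uniform_of_fmtStep`).

HONEST FRAMING (binding).  By-name composition of two landed door leaves and [folklore] real analysis; the four rows ∕ the format step ∕ `hRoad` are DISPLAYED HYPOTHESES inhabited
nowhere (with `e` unpinned they price nothing; pinned, the step row is NODE O's wall at one step — [I] §1 p.264 «uniformly bounded», (1.18) heredity, proof unpublished [II] p.355);
nothing of Bałaban asserted or discharged; NO β estimate; stub 3ᴬ′ᴮ NOT proved; K0ᴬ stmt-QuantumFields-27238 NOT closed (the gate matches a registered stub only against a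
hypothesis-free theorem); K1ᴬ 27239 ∕ K3ᴬ 27247 OPEN; K0⁷ 20541 aside, untouched; NODE O NOT inhabited; N07 NOT discharged; COUNT 8∕28 · K 1∕4 UNMOVED; R4 = the CONDITIONAL
finite-𝕋⁴ rung `BalabanLadder.UV` at fixed `ε = L^(−K)` only; NOT continuum ∕ ℝ⁴ ∕ OS; the Yang–Mills mass gap (Clay) is NOT proved by any of this.
-/

noncomputable section

namespace Summit.QuantumFields.YangMills.Theorems.K0V23Stub3FlowGronwallRadiusDoorsAx

open Literature.MathematicalPhysics.QuantumFieldTheory.Balaban1983to89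
open Literature.MathematicalPhysics.QuantumFieldTheory.Balaban1983to89.Node00
open Literature.MathematicalPhysics.QuantumFieldTheory.Balaban1983to89.T4Continuum
open Literature.MathematicalPhysics.QuantumFieldTheory.Balaban1983to89.FlowStep
open Summit.QuantumFields.YangMills.Theorems.K0V23Stub3FlowGronwallDoor (betaBox_of_flowRowsHistOn fmt_uniform_of_fmtStep fmt_uniform_of_fmtStepMem)
open Summit.QuantumFields.YangMills.Theorems.K0V23Stub3FlowGronwallDoorAx (k0BoxSmallRadiiAxAt_of_flowRowsHist)
open Summit.QuantumFields.YangMills.Theorems.K0V23Stub3DoorSuppliersAx (K0BoxSmallRadiiAx K0BoxCofinalRadiiAx record13SepCoPHInhabitedAx_of_k0BoxSmallRadii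
  record13SepCoPHInhabitedAx_of_k0BoxCofinalRadii)

/-! ## §1. SMALL radii: rows at one member per radius `a₀ ≤ a⋆(F)` ⟹ (α_small) ⟹ K0ᴬ's decl -/

/-- **★★ FLOW ROWS AT ONE MEMBER PER SMALL RADIUS ⟹ DOOR (α_small) `K0BoxSmallRadiiAx`** (the named door of DEF-1's leaf, via this seat's unfolded radius-axis edition).  CONDITIONAL on the
rows; nothing of Bałaban asserted. [cite: Balaban1987RG1, Thm 1 p.259, Thm 3 p.264, (1.18) p.263, (1.20)–(1.22) p.264; Balaban1989LargeFieldII, p.355] -/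
theorem k0BoxSmallRadiiAx_of_flowRowsHist
    (h : ∀ F : T4Family, ∃ aS : ℝ, 0 < aS ∧ ∀ a₀ : ℝ, 0 < a₀ → a₀ ≤ aS →
      ∃ (j : ℕ) (ε₀ ε₂₉ B₃ B₃' a₁ : ℝ) (Efl logz : B12.RunParams → ℕ → ℝ) (γ γbar : ℝ)
        (e : (k : ℕ) → (Fin (k + 1) → ℝ) → ℝ) (b : ℕ → ℝ) (θ b₀ b₁ Λ A₀ A a₀' a₁' B : ℝ),
        0 < ε₂₉ ∧ 0 < γ ∧ γ ≤ γbar ∧ 0 ≤ θ ∧ 0 ≤ b₀ ∧ 0 ≤ b₁ ∧ 0 ≤ Λ ∧ θ + γ * Λ < 1 ∧ 0 ≤ A ∧ 0 ≤ a₀' ∧ 0 ≤ a₁' ∧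
        letI β : HBeta := betaOfRecord₁₃Ax F 2 (theta13OfThm1CCMWZBAx F 2 j (1 / 2) a₀ ε₀ ε₂₉ B₃ B₃' a₀ a₁ Efl logz)
        (∀ (k : ℕ) (v : Fin (k + 2) → ℝ) (E : ℝ), v ∈ Box γbar (k + 1) → 0 ≤ E →
          (∀ (i : ℕ) (hi : i + 1 ≤ k + 1), e i (fun t => v (Fin.castLE (hi.trans (Nat.le_succ _)) t)) ≤ E) →
          e (k + 1) v ≤ θ * E + b₀ + v (Fin.last (k + 1)) * (b₁ + Λ * E)) ∧
        (∀ v : Fin 1 → ℝ, v ∈ Box γbar 0 → e 0 v ≤ b₀ + v 0 * b₁) ∧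
        (∀ v : Fin 1 → ℝ, v ∈ Box γbar 0 → |β 0 v - b 0| ≤ A₀ + v 0 * a₀') ∧
        (∀ (k : ℕ) (v : Fin (k + 2) → ℝ), v ∈ Box γbar (k + 1) →
          |β (k + 1) v - b (k + 1)| ≤ A₀ + A * e k (Fin.init v) + v (Fin.last (k + 1)) * (a₀' + a₁' * e k (Fin.init v))) ∧
        (∀ k, |b k| ≤ B)) :
    K0BoxSmallRadiiAx := fun F => by
  obtain ⟨aS, haS, h'⟩ := h F
  exact k0BoxSmallRadiiAxAt_of_flowRowsHist F haS h'

/-- **★★★ THE END OF A LENS-2 g1 LINE, BY NAME**: flow rows at one member per small radius ⟹ K0ᴬ's decl `Theses.BalabanUVNodes.Record13SepCoPHInhabitedAx` (through door (α_small) of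
record, `K0V23Stub3DoorSuppliersAx.record13SepCoPHInhabitedAx_of_k0BoxSmallRadii`).  CONDITIONAL on the rows; K0ᴬ NOT closed by this (hypotheses displayed).
[cite: Balaban1987RG1, Thm 1 p.259, Thm 3 p.264, (1.18) p.263, (1.20)–(1.22) p.264; Balaban1985Variational, Thm 1 (8)–(9) p.279, Prop. 8 p.304; Balaban1988Convergent, Thm 1 p.262; Balaban1989LargeFieldII, p.355] -/
theorem record13SepCoPHInhabitedAx_of_flowRowsHist
    (h : ∀ F : T4Family, ∃ aS : ℝ, 0 < aS ∧ ∀ a₀ : ℝ, 0 < a₀ → a₀ ≤ aS →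
      ∃ (j : ℕ) (ε₀ ε₂₉ B₃ B₃' a₁ : ℝ) (Efl logz : B12.RunParams → ℕ → ℝ) (γ γbar : ℝ)
        (e : (k : ℕ) → (Fin (k + 1) → ℝ) → ℝ) (b : ℕ → ℝ) (θ b₀ b₁ Λ A₀ A a₀' a₁' B : ℝ),
        0 < ε₂₉ ∧ 0 < γ ∧ γ ≤ γbar ∧ 0 ≤ θ ∧ 0 ≤ b₀ ∧ 0 ≤ b₁ ∧ 0 ≤ Λ ∧ θ + γ * Λ < 1 ∧ 0 ≤ A ∧ 0 ≤ a₀' ∧ 0 ≤ a₁' ∧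
        letI β : HBeta := betaOfRecord₁₃Ax F 2 (theta13OfThm1CCMWZBAx F 2 j (1 / 2) a₀ ε₀ ε₂₉ B₃ B₃' a₀ a₁ Efl logz)
        (∀ (k : ℕ) (v : Fin (k + 2) → ℝ) (E : ℝ), v ∈ Box γbar (k + 1) → 0 ≤ E →
          (∀ (i : ℕ) (hi : i + 1 ≤ k + 1), e i (fun t => v (Fin.castLE (hi.trans (Nat.le_succ _)) t)) ≤ E) →
          e (k + 1) v ≤ θ * E + b₀ + v (Fin.last (k + 1)) * (b₁ + Λ * E)) ∧
        (∀ v : Fin 1 → ℝ, v ∈ Box γbar 0 → e 0 v ≤ b₀ + v 0 * b₁) ∧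
        (∀ v : Fin 1 → ℝ, v ∈ Box γbar 0 → |β 0 v - b 0| ≤ A₀ + v 0 * a₀') ∧
        (∀ (k : ℕ) (v : Fin (k + 2) → ℝ), v ∈ Box γbar (k + 1) →
          |β (k + 1) v - b (k + 1)| ≤ A₀ + A * e k (Fin.init v) + v (Fin.last (k + 1)) * (a₀' + a₁' * e k (Fin.init v))) ∧
        (∀ k, |b k| ≤ B)) :
    Summit.QuantumFields.YangMills.Theses.BalabanUVNodes.Record13SepCoPHInhabitedAx :=
  record13SepCoPHInhabitedAx_of_k0BoxSmallRadii (k0BoxSmallRadiiAx_of_flowRowsHist h)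

/-! ## §2. COFINAL radii: rows at one member for radii accumulating at `0` ⟹ (α_cof) ⟹ K0ᴬ's decl -/

/-- **FLOW ROWS AT ONE MEMBER FOR COFINAL RADII ⟹ DOOR (α_cof) `K0BoxCofinalRadiiAx`**: for every `F` and every `a > 0` SOME radius `a₀ ∈ ]0, a]`, ONE member there, box sides and flow data
carrying the four rows.  CONDITIONAL on the rows. [cite: Balaban1987RG1, Thm 1 p.259, Thm 3 p.264, (1.18) p.263, (1.20)–(1.22) p.264; Balaban1989LargeFieldII, p.355] -/
theorem k0BoxCofinalRadiiAx_of_flowRowsHistCofinal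
    (h : ∀ (F : T4Family) (a : ℝ), 0 < a → ∃ a₀ : ℝ, 0 < a₀ ∧ a₀ ≤ a ∧
      ∃ (j : ℕ) (ε₀ ε₂₉ B₃ B₃' a₁ : ℝ) (Efl logz : B12.RunParams → ℕ → ℝ) (γ γbar : ℝ)
        (e : (k : ℕ) → (Fin (k + 1) → ℝ) → ℝ) (b : ℕ → ℝ) (θ b₀ b₁ Λ A₀ A a₀' a₁' B : ℝ),
        0 < ε₂₉ ∧ 0 < γ ∧ γ ≤ γbar ∧ 0 ≤ θ ∧ 0 ≤ b₀ ∧ 0 ≤ b₁ ∧ 0 ≤ Λ ∧ θ + γ * Λ < 1 ∧ 0 ≤ A ∧ 0 ≤ a₀' ∧ 0 ≤ a₁' ∧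
        letI β : HBeta := betaOfRecord₁₃Ax F 2 (theta13OfThm1CCMWZBAx F 2 j (1 / 2) a₀ ε₀ ε₂₉ B₃ B₃' a₀ a₁ Efl logz)
        (∀ (k : ℕ) (v : Fin (k + 2) → ℝ) (E : ℝ), v ∈ Box γbar (k + 1) → 0 ≤ E →
          (∀ (i : ℕ) (hi : i + 1 ≤ k + 1), e i (fun t => v (Fin.castLE (hi.trans (Nat.le_succ _)) t)) ≤ E) →
          e (k + 1) v ≤ θ * E + b₀ + v (Fin.last (k + 1)) * (b₁ + Λ * E)) ∧
        (∀ v : Fin 1 → ℝ, v ∈ Box γbar 0 → e 0 v ≤ b₀ + v 0 * b₁) ∧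
        (∀ v : Fin 1 → ℝ, v ∈ Box γbar 0 → |β 0 v - b 0| ≤ A₀ + v 0 * a₀') ∧
        (∀ (k : ℕ) (v : Fin (k + 2) → ℝ), v ∈ Box γbar (k + 1) →
          |β (k + 1) v - b (k + 1)| ≤ A₀ + A * e k (Fin.init v) + v (Fin.last (k + 1)) * (a₀' + a₁' * e k (Fin.init v))) ∧
        (∀ k, |b k| ≤ B)) :
    K0BoxCofinalRadiiAx := fun F a ha => by
  obtain ⟨a₀, ha₀, hle, j, ε₀, ε₂₉, B₃, B₃', a₁, Efl, logz, γ, γbar, e, b, θ, b₀, b₁, Λ, A₀, A, a₀', a₁', B, hε₂₉, hγ, hγbar, hθ, hb₀, hb₁, hΛ,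
    hgap, hA, ha₀', ha₁', hstep, hbase, hread0, hread, hcap⟩ := h F a ha
  obtain ⟨hlo, hup⟩ := betaBox_of_flowRowsHistOn hθ hb₀ hb₁ hΛ hγ.le hγbar hgap hA ha₀' ha₁' hstep hbase hread0 hread hcap
  exact ⟨a₀, ha₀, hle, γ, ε₂₉, _, j, ε₀, B₃, B₃', a₁, Efl, logz, hγ, hε₂₉, hlo, hup⟩

/-- **THE COFINAL END, BY NAME**: flow rows at one member for cofinal radii ⟹ K0ᴬ's decl (through door (α_cof), `K0V23Stub3DoorSuppliersAx.record13SepCoPHInhabitedAx_of_k0BoxCofinalRadii`).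
CONDITIONAL on the rows; K0ᴬ NOT closed by this. [cite: Balaban1987RG1, Thm 1 p.259, Thm 3 p.264, (1.18) p.263; Balaban1985Variational, Thm 1 (8)–(9) p.279, Prop. 8 p.304; Balaban1988Convergent, Thm 1 p.262; Balaban1989LargeFieldII, p.355] -/
theorem record13SepCoPHInhabitedAx_of_flowRowsHistCofinal
    (h : ∀ (F : T4Family) (a : ℝ), 0 < a → ∃ a₀ : ℝ, 0 < a₀ ∧ a₀ ≤ a ∧
      ∃ (j : ℕ) (ε₀ ε₂₉ B₃ B₃' a₁ : ℝ) (Efl logz : B12.RunParams → ℕ → ℝ) (γ γbar : ℝ)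
        (e : (k : ℕ) → (Fin (k + 1) → ℝ) → ℝ) (b : ℕ → ℝ) (θ b₀ b₁ Λ A₀ A a₀' a₁' B : ℝ),
        0 < ε₂₉ ∧ 0 < γ ∧ γ ≤ γbar ∧ 0 ≤ θ ∧ 0 ≤ b₀ ∧ 0 ≤ b₁ ∧ 0 ≤ Λ ∧ θ + γ * Λ < 1 ∧ 0 ≤ A ∧ 0 ≤ a₀' ∧ 0 ≤ a₁' ∧
        letI β : HBeta := betaOfRecord₁₃Ax F 2 (theta13OfThm1CCMWZBAx F 2 j (1 / 2) a₀ ε₀ ε₂₉ B₃ B₃' a₀ a₁ Efl logz)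
        (∀ (k : ℕ) (v : Fin (k + 2) → ℝ) (E : ℝ), v ∈ Box γbar (k + 1) → 0 ≤ E →
          (∀ (i : ℕ) (hi : i + 1 ≤ k + 1), e i (fun t => v (Fin.castLE (hi.trans (Nat.le_succ _)) t)) ≤ E) →
          e (k + 1) v ≤ θ * E + b₀ + v (Fin.last (k + 1)) * (b₁ + Λ * E)) ∧
        (∀ v : Fin 1 → ℝ, v ∈ Box γbar 0 → e 0 v ≤ b₀ + v 0 * b₁) ∧
        (∀ v : Fin 1 → ℝ, v ∈ Box γbar 0 → |β 0 v - b 0| ≤ A₀ + v 0 * a₀') ∧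
        (∀ (k : ℕ) (v : Fin (k + 2) → ℝ), v ∈ Box γbar (k + 1) →
          |β (k + 1) v - b (k + 1)| ≤ A₀ + A * e k (Fin.init v) + v (Fin.last (k + 1)) * (a₀' + a₁' * e k (Fin.init v))) ∧
        (∀ k, |b k| ≤ B)) :
    Summit.QuantumFields.YangMills.Theses.BalabanUVNodes.Record13SepCoPHInhabitedAx :=
  record13SepCoPHInhabitedAx_of_k0BoxCofinalRadii (k0BoxCofinalRadiiAx_of_flowRowsHistCofinal h)

/-! ## §3. THE FORMAT-PREDICATE END, RE-CENTRED — the shape of lens-2's LINE `lineEnd` ∕ `record13SepCoPHInhabited_of_stepMemHalf` (HOME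
`nodeO-cover/LENS-2-Line-flow-gronwall-ttel.lean` v3.11∕v3.12): a level-wise FORMAT predicate `FmtAt F a₀ ε₂₉ γ k v E` monotone in `E`, lens-1's road «k-uniform format ⟹ |β| box at the
member» taken as a DISPLAYED hypothesis `hRoad`, and the ONE k-free stub «full-memory format reproduction with contraction below thresholds» ⟹ K0ᴬ's decl through door (α_small),
with the predicate Grönwall `K0V23Stub3FlowGronwallDoor.fmt_uniform_of_fmtStepMem` (v1.1) in between.  Generic gain `ρ < 1` (the line pins `ρ := 1/2`). -/

/-- **★★★ THE FORMAT-PREDICATE END OF A LENS-2 LINE, BY NAME** (full-memory step): `FmtAt` monotone in its constant + `hRoad` (uniform format on `Box γ` ⟹ an |β| box for the letter-free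
member at radius `a₀`, species `ε₂₉`, window `γ`) + for every `F` thresholds `a⋆, ε⋆, γ⋆ > 0`, a gain `ρ < 1` and sources `σ₀, b₁ ≥ 0` such that for every radius `a₀ ≤ a⋆` the format at
`(a₀, ε⋆, γ⋆)` reproduces one generation down with full memory (`E ↦ ρE + σ₀ + g_n b₁` on `Box γ⋆`, older generations at the restricted histories) ⟹ `Record13SepCoPHInhabitedAx`.
CONDITIONAL on the three displayed hypotheses (the step is NODE O's wall at one step; `hRoad` is lens-1's road); K0ᴬ NOT closed by this.
[cite: Balaban1987RG1, Thm 1 p.259, Thm 3 p.264, (1.7) p.261, (1.18) p.263, (1.20)–(1.22) p.264; Balaban1985Variational, Thm 1 (8)–(9) p.279, Prop. 8 p.304; Balaban1988Convergent, Thm 1 p.262; Balaban1989LargeFieldII, p.355] -/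
theorem record13SepCoPHInhabitedAx_of_fmtStepMem
    (FmtAt : T4Family → ℝ → ℝ → ℝ → (k : ℕ) → (Fin (k + 1) → ℝ) → ℝ → Prop)
    (hmono : ∀ (F : T4Family) (a₀ ε₂₉ γ : ℝ) (k : ℕ) (v : Fin (k + 1) → ℝ) (E E' : ℝ), E ≤ E' → FmtAt F a₀ ε₂₉ γ k v E → FmtAt F a₀ ε₂₉ γ k v E')
    (hRoad : ∀ (F : T4Family) (a₀ ε₂₉ γ E₀ : ℝ), 0 < a₀ → 0 < ε₂₉ → 0 < γ → 0 ≤ E₀ →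
      (∀ (k : ℕ) (v : Fin (k + 1) → ℝ), v ∈ Box γ k → FmtAt F a₀ ε₂₉ γ k v E₀) →
        ∃ β' : ℝ, BetaLowerH (-β') γ (betaOfRecord₁₃Ax F 2 (theta13OfThm1CCMWZBAx F 2 0 (1 / 2) a₀ 0 ε₂₉ 0 0 a₀ 0 (fun _ _ => 0) (fun _ _ => 0))) ∧
          BetaUpperH β' γ (betaOfRecord₁₃Ax F 2 (theta13OfThm1CCMWZBAx F 2 0 (1 / 2) a₀ 0 ε₂₉ 0 0 a₀ 0 (fun _ _ => 0) (fun _ _ => 0))))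
    (hstep : ∀ F : T4Family, ∃ (aS εS γS ρ σ₀ b₁ : ℝ), 0 < aS ∧ 0 < εS ∧ 0 < γS ∧ ρ < 1 ∧ 0 ≤ σ₀ ∧ 0 ≤ b₁ ∧
      ∀ a₀ : ℝ, 0 < a₀ → a₀ ≤ aS →
        ∀ (n : ℕ) (v : Fin (n + 1) → ℝ) (E : ℝ), v ∈ Box γS n → 0 ≤ E →
          (∀ (j : ℕ) (hj : j < n), FmtAt F a₀ εS γS j (fun i => v (Fin.castLE (by omega) i)) E) →
          FmtAt F a₀ εS γS n v (ρ * E + σ₀ + v (Fin.last n) * b₁)) :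
    Summit.QuantumFields.YangMills.Theses.BalabanUVNodes.Record13SepCoPHInhabitedAx := by
  refine record13SepCoPHInhabitedAx_of_k0BoxSmallRadii fun F => ?_
  obtain ⟨aS, εS, γS, ρ, σ₀, b₁, haS, hεS, hγS, hρ, hσ₀, hb₁, hst⟩ := hstep F
  refine ⟨aS, haS, fun a₀ ha₀ hle => ?_⟩
  have hunif := fmt_uniform_of_fmtStepMem (Fmt := FmtAt F a₀ εS γS) hγS.le le_rfl hρ hσ₀ hb₁ (hmono F a₀ εS γS) (hst a₀ ha₀ hle)
  have hMnn : 0 ≤ (σ₀ + γS * b₁) / (1 - ρ) := div_nonneg (by positivity) (by linarith)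
  obtain ⟨β', hlo, hup⟩ := hRoad F a₀ εS γS _ ha₀ hεS hγS hMnn hunif
  exact ⟨γS, εS, β', 0, 0, 0, 0, 0, fun _ _ => 0, fun _ _ => 0, hγS, hεS, hlo, hup⟩

/-- **THE FORMAT-PREDICATE END, LAST-LEVEL STEP + BASE** (the line's §16 `record13SepCoPHInhabited_of_fmtGronwall` shape): base format `B₀ ≥ 0` at generation `0` and the last-level
reproduction `E ↦ ρE + σ₀ + g_{k+1}b₁` below the thresholds, + `hmono` + `hRoad` ⟹ `Record13SepCoPHInhabitedAx`.  CONDITIONAL; K0ᴬ NOT closed by this.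
[cite: Balaban1987RG1, Thm 1 p.259, Thm 3 p.264, (1.18) p.263, (5.36)–(5.44) pp.297–298; Balaban1985Variational, Thm 1 (8)–(9) p.279; Balaban1988Convergent, Thm 1 p.262; Balaban1989LargeFieldII, p.355] -/
theorem record13SepCoPHInhabitedAx_of_fmtStep
    (FmtAt : T4Family → ℝ → ℝ → ℝ → (k : ℕ) → (Fin (k + 1) → ℝ) → ℝ → Prop)
    (hmono : ∀ (F : T4Family) (a₀ ε₂₉ γ : ℝ) (k : ℕ) (v : Fin (k + 1) → ℝ) (E E' : ℝ), E ≤ E' → FmtAt F a₀ ε₂₉ γ k v E → FmtAt F a₀ ε₂₉ γ k v E')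
    (hRoad : ∀ (F : T4Family) (a₀ ε₂₉ γ E₀ : ℝ), 0 < a₀ → 0 < ε₂₉ → 0 < γ → 0 ≤ E₀ →
      (∀ (k : ℕ) (v : Fin (k + 1) → ℝ), v ∈ Box γ k → FmtAt F a₀ ε₂₉ γ k v E₀) →
        ∃ β' : ℝ, BetaLowerH (-β') γ (betaOfRecord₁₃Ax F 2 (theta13OfThm1CCMWZBAx F 2 0 (1 / 2) a₀ 0 ε₂₉ 0 0 a₀ 0 (fun _ _ => 0) (fun _ _ => 0))) ∧
          BetaUpperH β' γ (betaOfRecord₁₃Ax F 2 (theta13OfThm1CCMWZBAx F 2 0 (1 / 2) a₀ 0 ε₂₉ 0 0 a₀ 0 (fun _ _ => 0) (fun _ _ => 0))))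
    (hstep : ∀ F : T4Family, ∃ (aS εS γS ρ B₀ σ₀ b₁ : ℝ), 0 < aS ∧ 0 < εS ∧ 0 < γS ∧ ρ < 1 ∧ 0 ≤ B₀ ∧ 0 ≤ b₁ ∧
      ∀ a₀ : ℝ, 0 < a₀ → a₀ ≤ aS →
        (∀ v : Fin 1 → ℝ, v ∈ Box γS 0 → FmtAt F a₀ εS γS 0 v B₀) ∧
        (∀ (k : ℕ) (v : Fin (k + 2) → ℝ) (E : ℝ), v ∈ Box γS (k + 1) → 0 ≤ E → FmtAt F a₀ εS γS k (Fin.init v) E →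
          FmtAt F a₀ εS γS (k + 1) v (ρ * E + σ₀ + v (Fin.last (k + 1)) * b₁))) :
    Summit.QuantumFields.YangMills.Theses.BalabanUVNodes.Record13SepCoPHInhabitedAx := by
  refine record13SepCoPHInhabitedAx_of_k0BoxSmallRadii fun F => ?_
  obtain ⟨aS, εS, γS, ρ, B₀, σ₀, b₁, haS, hεS, hγS, hρ, hB₀, hb₁, hst⟩ := hstep F
  refine ⟨aS, haS, fun a₀ ha₀ hle => ?_⟩
  obtain ⟨hbase, hst'⟩ := hst a₀ ha₀ hle
  have hunif := fmt_uniform_of_fmtStep (Fmt := FmtAt F a₀ εS γS) le_rfl hρ hB₀ hb₁ (hmono F a₀ εS γS) hbase hst'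
  have hMnn : 0 ≤ max B₀ ((σ₀ + γS * b₁) / (1 - ρ)) := hB₀.trans (le_max_left _ _)
  obtain ⟨β', hlo, hup⟩ := hRoad F a₀ εS γS _ ha₀ hεS hγS hMnn hunif
  exact ⟨γS, εS, β', 0, 0, 0, 0, 0, fun _ _ => 0, fun _ _ => 0, hγS, hεS, hlo, hup⟩

end Summit.QuantumFields.YangMills.Theorems.K0V23Stub3FlowGronwallRadiusDoorsAx

end
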